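import Literature.MathematicalPhysics.QuantumFieldTheory.Balaban1983to89.B10CompactBinding
import Summits.QuantumFields.YangMills.Theorems.BalabanUVNodesN08Concrete
import Summits.QuantumFields.Balaban3D.Proofs.FamilyLE

/-!
# Route «BalabanUVNodes» (cluster K3), Track-A DAG node N08 = [Balaban1985UV3] Thm 1 p. 257 ∕ Thm 2 p. 272 — THE KNIT BY NAME AT THE
# C-BINDING OF RECORD OVER THE d = 3 LANE'S **CONSTRUCTED** RUN FAMILY (densities `ρ_k = T^kρ₀` of (1)–(2), histories, the functional of
# (41) and the (41)∕(47) slot WITH BODIES), FROM THAT LANE'S (α) INPUTS — and the literal-reading negative edge on the same family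

Cell `pub-ymgap`, seat `pub-ymgap-dag-n08-a` gen 2 (KNIT-BY-NAME; HUMAN RULING D-0062; chair R424 venue, R434 «(Q2) = (C) COMPACT»: the binding of
record of the `b10` slot is `B10CompactBinding.ofPrintedAllXPNC`, leaf `DagDischarged.b10Compact X = B10.Thm1PrintedCompact X.runs10 ∧
B10.Thm2Printed X.runs10`).  `bears_on: R4∕N08`.  Filed `--supports stmt-QuantumFields-19183`.  THEOREMS ONLY: def-free, sorry-free, standard axioms;
everything analytic is an existing kernel theorem of the tree used BY NAME or an explicit hypothesis.

WHAT N08 IS.  `Dag.B10_main (DagBinding.leavesP w P)` = «[B5] → [B6] → [B7] → [B8] → [B9] → [B11] conclusions ⇒ leaf b10» (`Dag` :207).  Gen 0 of this seat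
knitted it over ABSTRACT tower runs carrying `B10Assembly.LeafSystem`s (`B10NodeKnit`, p408896), over abstract towers on the concrete d = 3 scales carrying
`UVStability3D.ConcreteLeaves` (`BalabanUVNodesN08Concrete`, p409457 — all 25 leaves hypotheses), and defined the C-binding (`B10CompactBinding`, p409874).

WHAT THIS FILE ADDS — THE SAME ON THE d = 3 LANE'S OWN CONSTRUCTION, MODULO ITS (α) INPUTS ONLY.  The `pub-balaban3d` lane CONSTRUCTS, for one group as
printed `(G, 𝔊)` (`Balaban1985CMP102.Setting.GroupModel`), primitive constants `𝔠 : Primitives.AlphaConsts L 𝔊.N`, and per lattice approximation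
`S : Scales L` print's external inputs `X S : Carriers.ExternalInputs S G` (the averaging `Ū` of [4] with its certificates, the minimizers of [7]) and
expansion data `𝔖 S k : Carriers.StepSeries …` (chart functions with values in `𝔤ᶜ`), the tower of record `Inputs.towerOf 𝔠.lane (X S) (𝔖 S) : B10.TowerRun`
— Wilson start (1), `ρ_{k+1} = Tρ_k` (2) as push-forward densities, the large-field histories of (38)–(40), the functional `LF` of (41), `E` by (62)∕(64),
the slot «ρ_k satisfies (41), (47)» PINNED to the typed displays — and PROVES (`UVStability3DInputs.runResiduals_of_alpha`, `FamilyLE.runResiduals_of_alpha_le`,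
`Residuals.analyticLeavesOf`, `EndTheorem.carrierEqs_pin`, `Inputs.usesConsts_inputOf`) that these towers carry `ConcreteLeaves` AS SOON AS the (α) INPUTS
`UVStability3DInputs.RunAlpha 𝔊 𝔠 (X S) (𝔖 S) (𝔄 S)` hold: the GAP binders G3D-01∕02∕04∕05∕06∕07∕08 «as cited» ((23), (27)–(29), (35), (45), (63) by [9],
[10], [13]–[15], [19]), the displays (26), (28), (44), (67), (68) about the minimizers of [6], [7], [B1] (3.24)(a)(c), the identifications R-ACT, the
regularity of the data, and the named residual rows R3D-01∕02 — the lane's LEAF-LEDGER §F, i.e. [Balaban1985UV3]'s PRINTED INPUTS FROM ITS CITED PAPERS as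
that lane typed them at the paper's own objects.  Hence, for a world whose B10 run family IS the constructed family on the `≤`-family of approximations
`FamilyLE.ScalesLE L ((min γ₀ 1)²)` (all ε, tori, K, g with terminal coupling `g²ε₀ ≤ (min γ₀ 1)²`, `γ₀ = 𝔠.gamma0` the minimum of the leaf thresholds) or on
the spine's exhibited family `Theorems.Family L (eps0Of γ₀)` («ε₀ … depending on the coupling constant g only», p. 256 L15–18):
* §1 (C) `b10_main_constructedLE_upC` ∕ `b10_main_constructed_upC`: at the C-binding of record N08 HOLDS, from `RunAlpha` on the family (in-edges unused);
  `b10Compact_constructedLE` is the leaf itself = Theorem 1 (compact reading) ∧ Theorem 2 FOR THE CONSTRUCTED DENSITIES.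
* §2 (L) `not_b10_main_constructedLE` ∕ `b10_main_constructedLE_iff_inEdge_fails`: at the literal N-binding over the same family, for a group with
  `d(𝔤) ≥ 1`, the node FAILS as soon as its six in-edges hold — reader's items (R1) (unit configuration: `Inputs.unitConfig0_inputOf`), (R2) (star count)
  DISCHARGED for the constructed towers, (R3) = `1 ≤ 𝔠.dimg`; the family contains arbitrarily fine lattices (`ScalesArithmetic.scales_fine_eps0Of`).
* §3 the record-predicate form `b10_main_at_record_of_constructedPin` (what a NODE 00 B10-pin to this family with the (α) rows as its DISPLAYED
  admissibility clause would instantiate — chair R434 (c1) idiom «ESTIMATE ASSUMED AS ADMISSIBILITY, GAPS row owed»; referee condition (A5) of ref-C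
  READ #4 applies to such a pin BY DESIGN and is for the chair to weigh) and (A1) NON-VACUITY of the pinned index families (`nonempty_scalesLE`,
  `nonempty_family_eps0Of`).
* §4 the bridge BY NAME to the lane's END-theorem objects: for the ∀-group data of `UVStability3DInputs.uvStability3D_of_inputs` the family of §1 IS
  `Theorems.runs (laneT 𝔠 X 𝔖).toConstruction G 𝔊 (eps0Of (𝔠 G 𝔊).gamma0)` (`rfl`), and the C-binding's leaf over it IS the conjunction
  `B10.Thm1PrintedCompact (runs …) ∧ B10.Thm2Printed (runs …)` that `UVStability3DInputs.not_literal_of_inputs` concludes (first conjunct).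
HONEST FRAMING: count-neutral kernel bookkeeping by name over the pub-balaban3d ∕ lit-balaban ∕ b2b lineages' theorems; NOT a discharge (NODE 00 has
not pinned `runs10` — at Stage 5 it is the residual `(θ.res.X P).runs10`; the (α) rows are HYPOTHESES whose joint satisfiability on the constructed data is
that lane's open programme, not claimed here); d = 3 lattice gauge theory on finite tori; nothing about d = 4, the continuum, OS axioms, a mass gap or
the Clay problem.
-/

namespace Summit.QuantumFields.YangMills.Theorems.BalabanUVNodesN08Constructed

open Literature.MathematicalPhysics.QuantumFieldTheory.Balaban1983to89
open Literature.MathematicalPhysics.QuantumFieldTheory.Balaban1983to89.DagBinding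
open Literature.MathematicalPhysics.QuantumFieldTheory.Balaban1983to89.DagDischargedII
open Literature.MathematicalPhysics.QuantumFieldTheory.Balaban1983to89.B10 (TowerRun Thm1Printed Thm2Printed Thm1PrintedCompact)
open Literature.MathematicalPhysics.QuantumFieldTheory.Balaban1983to89.DagDischarged (b10Compact)
open Literature.MathematicalPhysics.QuantumFieldTheory.Balaban1983to89.B10CompactBinding (ofPrintedAllXPNC)
open Literature.MathematicalPhysics.QuantumFieldTheory.Balaban1985CMP102.Setting
open Literature.MathematicalPhysics.QuantumFieldTheory.Balaban1985CMP102.Theorems (Family runs)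
open Summit.QuantumFields.Balaban3D.Carriers
open Summit.QuantumFields.Balaban3D.Proofs.Constants (eps0Of)
open Summit.QuantumFields.Balaban3D.Proofs.ScalesArithmetic (scales_fine_eps0Of)
open Summit.QuantumFields.Balaban3D.Proofs.UVStability3D (ConcreteLeaves leafSystem_of_concrete)
open Summit.QuantumFields.Balaban3D.Proofs.EndTheorem (carrierEqs_pin)
open Summit.QuantumFields.Balaban3D.Proofs.Inputs (towerOf usesConsts_inputOf unitConfig0_inputOf)
open Summit.QuantumFields.Balaban3D.Proofs.Residuals (analyticLeavesOf)
open Summit.QuantumFields.Balaban3D.Proofs.Primitives (AlphaConsts)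
open Summit.QuantumFields.Balaban3D.Proofs.GroupModelLieC (lieC)
open Summit.QuantumFields.Balaban3D.Proofs.UVStability3DInputs
open Summit.QuantumFields.Balaban3D.Proofs.FamilyLE (ScalesLE le_of_eps0Of runResiduals_of_alpha_le)
open Summit.QuantumFields.YangMills.Theorems.BalabanUVNodesN08Concrete
  (b10_main_concrete_upCompact not_b10_main_concrete_of_fine b10_main_concrete_iff_inEdge_fails_of_fine)

variable {L : ℕ} {G : Type} [GaugeGroup G] [MeasurableSpace G] [HaarData G] {𝔊 : GroupModel G} {𝔠 : AlphaConsts L 𝔊.N}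
  {X : ∀ S : Scales L, ExternalInputs S G}
  {𝔖 : ∀ (S : Scales L) (k : ℕ), StepSeries S G ↥(lieC 𝔊) (nblkOf S 𝔠.lane.carrier k) k}
  {𝔄 : ∀ S : Scales L, AlphaData 𝔊 𝔠 (X S) (𝔖 S)}
  {Xc : PrintedCarriersR} {Y : PrintedCarriers9X} {Z : PrintedCarriers11} {V : PrintedCarriers14R} {W : PrintedCarriers15}
  {w : WorldP} {P : B12.RunParams}

/-! ## §0 The constructed towers carry concrete leaf bundles as soon as the (α) inputs hold -/

/-- **THE CONSTRUCTED TOWER OF ONE LATTICE APPROXIMATION CARRIES THE CONCRETE LEAF BUNDLE, given the (α) inputs** on the `≤`-family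
(`S.g²·S.ε₀ ≤ (min γ₀ 1)²`): carrier equations by `EndTheorem.carrierEqs_pin` ∘ `Inputs.usesConsts_inputOf`, analytic leaves by
`Residuals.analyticLeavesOf` ∘ `FamilyLE.runResiduals_of_alpha_le`.  (Stated as inhabitation; the proofs below use the explicit term.)
[cite: Balaban1985UV3, pp.256–274 (the leaf list) + Thm 1 p.257 + Thm 2 p.272] -/
theorem nonempty_concreteLeaves_constructedLE (S : Scales L) (hle : S.g ^ 2 * S.ε₀ ≤ (min 𝔠.gamma0 1) ^ 2)
    (R : RunAlpha 𝔊 𝔠 (X S) (𝔖 S) (𝔄 S)) : Nonempty (ConcreteLeaves 𝔠.lane.consts S (towerOf 𝔠.lane (X S) (𝔖 S))) :=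
  ⟨{ toCarrierEqs := carrierEqs_pin _ (usesConsts_inputOf 𝔠.lane (X S) (𝔖 S) fun _ => True)
     toAnalyticLeaves := analyticLeavesOf (runResiduals_of_alpha_le hle R) }⟩

/-- The same on the spine's exhibited family `S.ε₀ = ε₀(S.g) = (min γ₀ 1)²/S.g²` (`UVStability3DInputs.runResiduals_of_alpha`).
[cite: Balaban1985UV3, pp.256–274 + p.256 L15–18] -/
theorem nonempty_concreteLeaves_constructed (S : Scales L) (hS : S.ε₀ = eps0Of 𝔠.gamma0 S.g)
    (R : RunAlpha 𝔊 𝔠 (X S) (𝔖 S) (𝔄 S)) : Nonempty (ConcreteLeaves 𝔠.lane.consts S (towerOf 𝔠.lane (X S) (𝔖 S))) :=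
  ⟨{ toCarrierEqs := carrierEqs_pin _ (usesConsts_inputOf 𝔠.lane (X S) (𝔖 S) fun _ => True)
     toAnalyticLeaves := analyticLeavesOf (runResiduals_of_alpha hS R) }⟩

/-! ## §1 The COMPACT node at the C-binding of record over the constructed run family -/

section LE

variable (hα : ∀ S : Scales L, S.g ^ 2 * S.ε₀ ≤ (min 𝔠.gamma0 1) ^ 2 → RunAlpha 𝔊 𝔠 (X S) (𝔖 S) (𝔄 S))
include hα

/-- **THEOREM 1 (compact reading) ∧ THEOREM 2 FOR THE CONSTRUCTED DENSITIES = THE C-BINDING'S LEAF**, on the `≤`-family: from the (α) inputs,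
`DagDischarged.b10Compact` holds for any carriers whose B10 run family is `S ↦ (towerOf 𝔠.lane (X S) (𝔖 S)).toRunData` on `ScalesLE L ((min γ₀ 1)²)`
(`DagDischarged.b10Compact_withTowerRuns10_of_leafSystems` ∘ `UVStability3D.leafSystem_of_concrete`). [cite: Balaban1985UV3, Thm 1 p.257 (compact reading) + Thm 2 p.272] -/
theorem b10Compact_constructedLE (Xc : PrintedCarriersR) :
    b10Compact (Xc.withTowerRuns10 fun S : ScalesLE L ((min 𝔠.gamma0 1) ^ 2) =>
      towerOf 𝔠.lane (X S.1) (𝔖 S.1)).toPrintedCarriers :=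
  DagDischarged.b10Compact_withTowerRuns10_of_leafSystems Xc _ fun S =>
    leafSystem_of_concrete 𝔠.lane.normalised
      ({ toCarrierEqs := carrierEqs_pin _ (usesConsts_inputOf 𝔠.lane (X S.1) (𝔖 S.1) fun _ => True)
         toAnalyticLeaves := analyticLeavesOf (runResiduals_of_alpha_le S.2 (hα S.1 S.2)) } :
        ConcreteLeaves 𝔠.lane.consts S.1 (towerOf 𝔠.lane (X S.1) (𝔖 S.1)))

/-- **N08 BY NAME AT THE C-BINDING OF RECORD (R434) OVER THE CONSTRUCTED RUN FAMILY, `≤`-family**: if `w.up P = B10CompactBinding.ofPrintedAllXPNC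
(Xc.withTowerRuns10 (S ↦ towerOf 𝔠.lane (X S) (𝔖 S))) Y Z V W` over `ScalesLE L ((min γ₀ 1)²)` and the (α) inputs hold on that family, then
`Dag.B10_main (leavesP w P)` (in-edges unused).  `B10CompactBinding.b10_main_of_upC` with the leaf systems rebuilt from the constructed bundles.
[cite: Balaban1985UV3, Thm 1 p.257 (compact reading) + Thm 2 p.272] -/
theorem b10_main_constructedLE_upC
    (hup : w.up P = ofPrintedAllXPNC (Xc.withTowerRuns10 fun S : ScalesLE L ((min 𝔠.gamma0 1) ^ 2) =>
      towerOf 𝔠.lane (X S.1) (𝔖 S.1)) Y Z V W) :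
    Dag.B10_main (leavesP w P) :=
  B10CompactBinding.b10_main_of_upC (fun S : ScalesLE L ((min 𝔠.gamma0 1) ^ 2) =>
    leafSystem_of_concrete 𝔠.lane.normalised
      ({ toCarrierEqs := carrierEqs_pin _ (usesConsts_inputOf 𝔠.lane (X S.1) (𝔖 S.1) fun _ => True)
         toAnalyticLeaves := analyticLeavesOf (runResiduals_of_alpha_le S.2 (hα S.1 S.2)) } :
        ConcreteLeaves 𝔠.lane.consts S.1 (towerOf 𝔠.lane (X S.1) (𝔖 S.1)))) hup

/-- The same at the structure-update spelling of the compact re-binding (the shape of `B10NodeKnit.b10_main_of_upCompact` ∕ gen 0's concrete knit).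
[cite: Balaban1985UV3, Thm 1 p.257 (compact reading) + Thm 2 p.272] -/
theorem b10_main_constructedLE_upCompact
    (hupC : w.up P = { Upstream.ofPrintedAllXPN (Xc.withTowerRuns10 fun S : ScalesLE L ((min 𝔠.gamma0 1) ^ 2) =>
        towerOf 𝔠.lane (X S.1) (𝔖 S.1)) Y Z V W with
      b10 := b10Compact (Xc.withTowerRuns10 fun S : ScalesLE L ((min 𝔠.gamma0 1) ^ 2) =>
        towerOf 𝔠.lane (X S.1) (𝔖 S.1)).toPrintedCarriers }) :
    Dag.B10_main (leavesP w P) :=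
  b10_main_concrete_upCompact 𝔠.lane.normalised (fun S : ScalesLE L ((min 𝔠.gamma0 1) ^ 2) =>
    ({ toCarrierEqs := carrierEqs_pin _ (usesConsts_inputOf 𝔠.lane (X S.1) (𝔖 S.1) fun _ => True)
       toAnalyticLeaves := analyticLeavesOf (runResiduals_of_alpha_le S.2 (hα S.1 S.2)) } :
      ConcreteLeaves 𝔠.lane.consts S.1 (towerOf 𝔠.lane (X S.1) (𝔖 S.1)))) hupC

/-! ## §2 The LITERAL reading on the same constructed family — the negative edge at the node -/

/-- **N08, LITERAL READING, CONSTRUCTED FAMILY — THE NEGATIVE EDGE**: for a group with `d(𝔤) ≥ 1` (`1 ≤ 𝔠.dimg`; reader's item (R3)), at the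
literal N-binding over the constructed run family on `ScalesLE L ((min γ₀ 1)²)` the node FAILS as soon as its six in-edge leaves hold — (R1) the unit
configuration is DISCHARGED for the constructed towers (`Inputs.unitConfig0_inputOf`), (R2) by the concrete star count, and the family contains
approximations with one step and arbitrarily small bare coupling (`ScalesArithmetic.scales_fine_eps0Of`, inside the `≤`-family by `FamilyLE.le_of_eps0Of`).
By (62) p. 271 `−E` carries `d(𝔤)|T₁^{(j)*}| log g_j⁻¹`. [cite: Balaban1985UV3, Thm 1 p.257 (typing), (62) p.271] -/
theorem not_b10_main_constructedLE (hL : Odd L ∧ 1 < L) (hdim : 1 ≤ 𝔠.dimg)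
    (hup : w.up P = Upstream.ofPrintedAllXPN (Xc.withTowerRuns10 fun S : ScalesLE L ((min 𝔠.gamma0 1) ^ 2) =>
      towerOf 𝔠.lane (X S.1) (𝔖 S.1)) Y Z V W)
    (h5 : (Upstream.ofPrintedAllXPN (Xc.withTowerRuns10 fun S : ScalesLE L ((min 𝔠.gamma0 1) ^ 2) =>
      towerOf 𝔠.lane (X S.1) (𝔖 S.1)) Y Z V W).b5)
    (h6 : (Upstream.ofPrintedAllXPN (Xc.withTowerRuns10 fun S : ScalesLE L ((min 𝔠.gamma0 1) ^ 2) =>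
      towerOf 𝔠.lane (X S.1) (𝔖 S.1)) Y Z V W).b6)
    (h7 : (Upstream.ofPrintedAllXPN (Xc.withTowerRuns10 fun S : ScalesLE L ((min 𝔠.gamma0 1) ^ 2) =>
      towerOf 𝔠.lane (X S.1) (𝔖 S.1)) Y Z V W).b7)
    (h8 : (Upstream.ofPrintedAllXPN (Xc.withTowerRuns10 fun S : ScalesLE L ((min 𝔠.gamma0 1) ^ 2) =>
      towerOf 𝔠.lane (X S.1) (𝔖 S.1)) Y Z V W).b8)
    (h9 : (Upstream.ofPrintedAllXPN (Xc.withTowerRuns10 fun S : ScalesLE L ((min 𝔠.gamma0 1) ^ 2) =>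
      towerOf 𝔠.lane (X S.1) (𝔖 S.1)) Y Z V W).b9)
    (h11 : (Upstream.ofPrintedAllXPN (Xc.withTowerRuns10 fun S : ScalesLE L ((min 𝔠.gamma0 1) ^ 2) =>
      towerOf 𝔠.lane (X S.1) (𝔖 S.1)) Y Z V W).b11) :
    ¬ Dag.B10_main (leavesP w P) :=
  not_b10_main_concrete_of_fine 𝔠.lane.normalised (fun S : ScalesLE L ((min 𝔠.gamma0 1) ^ 2) =>
    ({ toCarrierEqs := carrierEqs_pin _ (usesConsts_inputOf 𝔠.lane (X S.1) (𝔖 S.1) fun _ => True)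
       toAnalyticLeaves := analyticLeavesOf (runResiduals_of_alpha_le S.2 (hα S.1 S.2)) } :
      ConcreteLeaves 𝔠.lane.consts S.1 (towerOf 𝔠.lane (X S.1) (𝔖 S.1)))) hup one_pos
    (fun S k hk => by show (1 : ℝ) ≤ (𝔠.lane.F.dimg : ℝ); exact_mod_cast hdim)
    (fun S => unitConfig0_inputOf 𝔠.lane (X S.1) (𝔖 S.1))
    (fun δ hδ => by
      obtain ⟨S, -, hε, hK, hs⟩ := scales_fine_eps0Of hL 𝔠.gamma0_pos one_pos δ hδ
      exact ⟨⟨S, le_of_eps0Of S hε⟩, hK, hs⟩)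
    h5 h6 h7 h8 h9 h11

/-- **THE DICHOTOMY AT THE LITERAL BINDING, CONSTRUCTED FAMILY**: with `d(𝔤) ≥ 1`, the literal node holds iff one of its six in-edges FAILS at the
binding (it can only hold vacuously) — while §1 proves the compact node outright, from the same (α) inputs. [cite: Balaban1985UV3, Thm 1 p.257 (both readings), (62) p.271] -/
theorem b10_main_constructedLE_iff_inEdge_fails (hL : Odd L ∧ 1 < L) (hdim : 1 ≤ 𝔠.dimg)
    (hup : w.up P = Upstream.ofPrintedAllXPN (Xc.withTowerRuns10 fun S : ScalesLE L ((min 𝔠.gamma0 1) ^ 2) =>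
      towerOf 𝔠.lane (X S.1) (𝔖 S.1)) Y Z V W) :
    Dag.B10_main (leavesP w P) ↔
      ¬ ((Upstream.ofPrintedAllXPN (Xc.withTowerRuns10 fun S : ScalesLE L ((min 𝔠.gamma0 1) ^ 2) =>
            towerOf 𝔠.lane (X S.1) (𝔖 S.1)) Y Z V W).b5 ∧
          (Upstream.ofPrintedAllXPN (Xc.withTowerRuns10 fun S : ScalesLE L ((min 𝔠.gamma0 1) ^ 2) =>
            towerOf 𝔠.lane (X S.1) (𝔖 S.1)) Y Z V W).b6 ∧
          (Upstream.ofPrintedAllXPN (Xc.withTowerRuns10 fun S : ScalesLE L ((min 𝔠.gamma0 1) ^ 2) =>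
            towerOf 𝔠.lane (X S.1) (𝔖 S.1)) Y Z V W).b7 ∧
          (Upstream.ofPrintedAllXPN (Xc.withTowerRuns10 fun S : ScalesLE L ((min 𝔠.gamma0 1) ^ 2) =>
            towerOf 𝔠.lane (X S.1) (𝔖 S.1)) Y Z V W).b8 ∧
          (Upstream.ofPrintedAllXPN (Xc.withTowerRuns10 fun S : ScalesLE L ((min 𝔠.gamma0 1) ^ 2) =>
            towerOf 𝔠.lane (X S.1) (𝔖 S.1)) Y Z V W).b9 ∧
          (Upstream.ofPrintedAllXPN (Xc.withTowerRuns10 fun S : ScalesLE L ((min 𝔠.gamma0 1) ^ 2) =>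
            towerOf 𝔠.lane (X S.1) (𝔖 S.1)) Y Z V W).b11) :=
  b10_main_concrete_iff_inEdge_fails_of_fine 𝔠.lane.normalised (fun S : ScalesLE L ((min 𝔠.gamma0 1) ^ 2) =>
    ({ toCarrierEqs := carrierEqs_pin _ (usesConsts_inputOf 𝔠.lane (X S.1) (𝔖 S.1) fun _ => True)
       toAnalyticLeaves := analyticLeavesOf (runResiduals_of_alpha_le S.2 (hα S.1 S.2)) } :
      ConcreteLeaves 𝔠.lane.consts S.1 (towerOf 𝔠.lane (X S.1) (𝔖 S.1)))) hup one_pos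
    (fun S k hk => by show (1 : ℝ) ≤ (𝔠.lane.F.dimg : ℝ); exact_mod_cast hdim)
    (fun S => unitConfig0_inputOf 𝔠.lane (X S.1) (𝔖 S.1))
    (fun δ hδ => by
      obtain ⟨S, -, hε, hK, hs⟩ := scales_fine_eps0Of hL 𝔠.gamma0_pos one_pos δ hδ
      exact ⟨⟨S, le_of_eps0Of S hε⟩, hK, hs⟩)

/-- **BOTH READINGS SIDE BY SIDE on the constructed family** (the kernel form of cell GAPS G-B10-01 for the lane's own densities): from the (α) inputs,
the compact node holds and — for `d(𝔤) ≥ 1` — the literal `b10` leaf of the N-binding fails. [cite: Balaban1985UV3, Thm 1 p.257 (both readings) + Thm 2 p.272 + (62) p.271] -/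
theorem compact_and_not_literal_constructedLE (hL : Odd L ∧ 1 < L) (hdim : 1 ≤ 𝔠.dimg) (Xc : PrintedCarriersR)
    (Y : PrintedCarriers9X) (Z : PrintedCarriers11) (V : PrintedCarriers14R) (W : PrintedCarriers15) :
    b10Compact (Xc.withTowerRuns10 fun S : ScalesLE L ((min 𝔠.gamma0 1) ^ 2) =>
        towerOf 𝔠.lane (X S.1) (𝔖 S.1)).toPrintedCarriers ∧
      ¬ (Upstream.ofPrintedAllXPN (Xc.withTowerRuns10 fun S : ScalesLE L ((min 𝔠.gamma0 1) ^ 2) =>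
        towerOf 𝔠.lane (X S.1) (𝔖 S.1)) Y Z V W).b10 := by
  refine ⟨b10Compact_constructedLE hα Xc, fun h => ?_⟩
  exact Balaban3D.Proofs.NegativeEdge.not_thm1Printed_concrete 𝔠.lane.consts 𝔠.lane.normalised
    (fun S : ScalesLE L ((min 𝔠.gamma0 1) ^ 2) => (towerOf 𝔠.lane (X S.1) (𝔖 S.1)).toRunData) (fun S => S.1)
    (fun S => towerOf 𝔠.lane (X S.1) (𝔖 S.1)) (fun _ => rfl)
    (fun S => ({ toCarrierEqs := carrierEqs_pin _ (usesConsts_inputOf 𝔠.lane (X S.1) (𝔖 S.1) fun _ => True)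
                 toAnalyticLeaves := analyticLeavesOf (runResiduals_of_alpha_le S.2 (hα S.1 S.2)) } :
      ConcreteLeaves 𝔠.lane.consts S.1 (towerOf 𝔠.lane (X S.1) (𝔖 S.1))))
    one_pos (fun S k hk => by show (1 : ℝ) ≤ (𝔠.lane.F.dimg : ℝ); exact_mod_cast hdim)
    (fun S => unitConfig0_inputOf 𝔠.lane (X S.1) (𝔖 S.1))
    (fun δ hδ => by
      obtain ⟨S, -, hε, hK, hs⟩ := scales_fine_eps0Of hL 𝔠.gamma0_pos one_pos δ hδ
      exact ⟨⟨S, le_of_eps0Of S hε⟩, hK, hs⟩)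
    ((B10NodeKnit.ofPrintedAllXPN_withTowerRuns10_b10_iff Xc Y Z V W _).1 h).1

end LE

/-! ## §1′–§2′ The same on the spine's exhibited family `Theorems.Family L (eps0Of γ₀)` («ε₀ depending on g only», p. 256 L15–18) -/

section Eps0

variable (hα : ∀ S : Scales L, S.ε₀ = eps0Of 𝔠.gamma0 S.g → RunAlpha 𝔊 𝔠 (X S) (𝔖 S) (𝔄 S))
include hα

/-- **THE C-BINDING'S LEAF on the exhibited family** `Family L (eps0Of γ₀)`: Theorem 1 (compact reading) ∧ Theorem 2 for the constructed densities,
from the (α) inputs there (`UVStability3DInputs.runResiduals_of_alpha`). [cite: Balaban1985UV3, Thm 1 p.257 (compact reading) + Thm 2 p.272 + p.256 L15–18] -/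
theorem b10Compact_constructed (Xc : PrintedCarriersR) :
    b10Compact (Xc.withTowerRuns10 fun S : Family L (eps0Of 𝔠.gamma0) =>
      towerOf 𝔠.lane (X S.1) (𝔖 S.1)).toPrintedCarriers :=
  DagDischarged.b10Compact_withTowerRuns10_of_leafSystems Xc _ fun S =>
    leafSystem_of_concrete 𝔠.lane.normalised
      ({ toCarrierEqs := carrierEqs_pin _ (usesConsts_inputOf 𝔠.lane (X S.1) (𝔖 S.1) fun _ => True)
         toAnalyticLeaves := analyticLeavesOf (runResiduals_of_alpha S.2 (hα S.1 S.2)) } :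
        ConcreteLeaves 𝔠.lane.consts S.1 (towerOf 𝔠.lane (X S.1) (𝔖 S.1)))

/-- **N08 BY NAME AT THE C-BINDING OF RECORD OVER THE CONSTRUCTED RUN FAMILY, exhibited family**: `Dag.B10_main (leavesP w P)` at
`w.up P = ofPrintedAllXPNC (Xc.withTowerRuns10 (S ↦ towerOf 𝔠.lane (X S) (𝔖 S))) Y Z V W` over `Family L (eps0Of γ₀)`, from the (α) inputs there
(in-edges unused). [cite: Balaban1985UV3, Thm 1 p.257 (compact reading) + Thm 2 p.272 + p.256 L15–18] -/
theorem b10_main_constructed_upC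
    (hup : w.up P = ofPrintedAllXPNC (Xc.withTowerRuns10 fun S : Family L (eps0Of 𝔠.gamma0) =>
      towerOf 𝔠.lane (X S.1) (𝔖 S.1)) Y Z V W) :
    Dag.B10_main (leavesP w P) :=
  B10CompactBinding.b10_main_of_upC (fun S : Family L (eps0Of 𝔠.gamma0) =>
    leafSystem_of_concrete 𝔠.lane.normalised
      ({ toCarrierEqs := carrierEqs_pin _ (usesConsts_inputOf 𝔠.lane (X S.1) (𝔖 S.1) fun _ => True)
         toAnalyticLeaves := analyticLeavesOf (runResiduals_of_alpha S.2 (hα S.1 S.2)) } :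
        ConcreteLeaves 𝔠.lane.consts S.1 (towerOf 𝔠.lane (X S.1) (𝔖 S.1)))) hup

/-- **THE DICHOTOMY AT THE LITERAL BINDING, exhibited family**, `d(𝔤) ≥ 1`: the literal node holds iff an in-edge fails.
[cite: Balaban1985UV3, Thm 1 p.257 (both readings), (62) p.271] -/
theorem b10_main_constructed_iff_inEdge_fails (hL : Odd L ∧ 1 < L) (hdim : 1 ≤ 𝔠.dimg)
    (hup : w.up P = Upstream.ofPrintedAllXPN (Xc.withTowerRuns10 fun S : Family L (eps0Of 𝔠.gamma0) =>
      towerOf 𝔠.lane (X S.1) (𝔖 S.1)) Y Z V W) :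
    Dag.B10_main (leavesP w P) ↔
      ¬ ((Upstream.ofPrintedAllXPN (Xc.withTowerRuns10 fun S : Family L (eps0Of 𝔠.gamma0) =>
            towerOf 𝔠.lane (X S.1) (𝔖 S.1)) Y Z V W).b5 ∧
          (Upstream.ofPrintedAllXPN (Xc.withTowerRuns10 fun S : Family L (eps0Of 𝔠.gamma0) =>
            towerOf 𝔠.lane (X S.1) (𝔖 S.1)) Y Z V W).b6 ∧
          (Upstream.ofPrintedAllXPN (Xc.withTowerRuns10 fun S : Family L (eps0Of 𝔠.gamma0) =>
            towerOf 𝔠.lane (X S.1) (𝔖 S.1)) Y Z V W).b7 ∧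
          (Upstream.ofPrintedAllXPN (Xc.withTowerRuns10 fun S : Family L (eps0Of 𝔠.gamma0) =>
            towerOf 𝔠.lane (X S.1) (𝔖 S.1)) Y Z V W).b8 ∧
          (Upstream.ofPrintedAllXPN (Xc.withTowerRuns10 fun S : Family L (eps0Of 𝔠.gamma0) =>
            towerOf 𝔠.lane (X S.1) (𝔖 S.1)) Y Z V W).b9 ∧
          (Upstream.ofPrintedAllXPN (Xc.withTowerRuns10 fun S : Family L (eps0Of 𝔠.gamma0) =>
            towerOf 𝔠.lane (X S.1) (𝔖 S.1)) Y Z V W).b11) :=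
  b10_main_concrete_iff_inEdge_fails_of_fine 𝔠.lane.normalised (fun S : Family L (eps0Of 𝔠.gamma0) =>
    ({ toCarrierEqs := carrierEqs_pin _ (usesConsts_inputOf 𝔠.lane (X S.1) (𝔖 S.1) fun _ => True)
       toAnalyticLeaves := analyticLeavesOf (runResiduals_of_alpha S.2 (hα S.1 S.2)) } :
      ConcreteLeaves 𝔠.lane.consts S.1 (towerOf 𝔠.lane (X S.1) (𝔖 S.1)))) hup one_pos
    (fun S k hk => by show (1 : ℝ) ≤ (𝔠.lane.F.dimg : ℝ); exact_mod_cast hdim)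
    (fun S => unitConfig0_inputOf 𝔠.lane (X S.1) (𝔖 S.1))
    (fun δ hδ => by
      obtain ⟨S, -, hε, hK, hs⟩ := scales_fine_eps0Of hL 𝔠.gamma0_pos one_pos δ hδ
      exact ⟨⟨S, hε⟩, hK, hs⟩)

end Eps0

/-! ## §3 The record-predicate form (the shape a NODE 00 B10-pin to this family instantiates) and (A1) non-vacuity of the pinned index families -/

/-- **(A1) THE `≤`-FAMILY IS INHABITED**: for `L` odd, `> 1` and `γ₀ > 0` there is a lattice approximation with terminal coupling
`g²ε₀ ≤ (min γ₀ 1)²` (indeed one with `K ≥ 1`; `ScalesArithmetic.scales_fine_eps0Of` + `FamilyLE.le_of_eps0Of`) — so a pin of `runs10` to this family is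
NOT a pin to an empty family (ref-C READ #4 condition (A1)). [cite: Balaban1985UV3, (2)–(3) p.256] -/
theorem nonempty_scalesLE (hL : Odd L ∧ 1 < L) {γ₀ : ℝ} (hγ : 0 < γ₀) : Nonempty (ScalesLE L ((min γ₀ 1) ^ 2)) := by
  obtain ⟨S, -, hε, -, -⟩ := scales_fine_eps0Of hL hγ one_pos 1 one_pos
  exact ⟨⟨S, le_of_eps0Of S hε⟩⟩

/-- **(A1) THE EXHIBITED FAMILY IS INHABITED**: `Theorems.Family L (eps0Of γ₀)` is non-empty for `L` odd `> 1`, `γ₀ > 0`. [cite: Balaban1985UV3, (2)–(3) p.256 + p.256 L15–18] -/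
theorem nonempty_family_eps0Of (hL : Odd L ∧ 1 < L) {γ₀ : ℝ} (hγ : 0 < γ₀) : Nonempty (Family L (eps0Of γ₀)) := by
  obtain ⟨S, -, hε, -, -⟩ := scales_fine_eps0Of hL hγ one_pos 1 one_pos
  exact ⟨⟨S, hε⟩⟩

/-- **RECORD-PREDICATE FORM** (the shape of dagwriter's `S_N08 Rec := AtRecord Rec Dag.B10_main` at a C-bound `Rec`, chair R434): for one group as
printed and block size `L`, and ANY predicate `Rec` on binding worlds under which, at every run, SOME constants ∕ external inputs ∕ expansion data ∕
auxiliary data whose (α) inputs hold on the `≤`-family bind the upstream as the C-binding over carriers whose B10 runs ARE the constructed family —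
N08 holds at every `Rec`-world and run.  What a NODE 00 B10-pin with the (α) rows as its DISPLAYED ADMISSIBILITY CLAUSE (R434 (c1) idiom) would
instantiate; under ref-C READ #4 (A5) such a pin carries print's inputs inside the record predicate BY DESIGN — whether that is the discharge of record is
the chair's word, not this file's claim. [cite: Balaban1985UV3, Thm 1 p.257 (compact reading) + Thm 2 p.272 (bookkeeping shape)] -/
theorem b10_main_at_record_of_constructedPin (Rec : WorldP → Prop)
    (hpin : ∀ w, Rec w → ∀ P : B12.RunParams,
      ∃ (𝔠 : AlphaConsts L 𝔊.N) (X : ∀ S : Scales L, ExternalInputs S G)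
        (𝔖 : ∀ (S : Scales L) (k : ℕ), StepSeries S G ↥(lieC 𝔊) (nblkOf S 𝔠.lane.carrier k) k)
        (𝔄 : ∀ S : Scales L, AlphaData 𝔊 𝔠 (X S) (𝔖 S))
        (Xc : PrintedCarriersR) (Y : PrintedCarriers9X) (Z : PrintedCarriers11) (V : PrintedCarriers14R) (W : PrintedCarriers15),
        (∀ S : Scales L, S.g ^ 2 * S.ε₀ ≤ (min 𝔠.gamma0 1) ^ 2 → RunAlpha 𝔊 𝔠 (X S) (𝔖 S) (𝔄 S)) ∧
          w.up P = ofPrintedAllXPNC (Xc.withTowerRuns10 fun S : ScalesLE L ((min 𝔠.gamma0 1) ^ 2) =>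
            towerOf 𝔠.lane (X S.1) (𝔖 S.1)) Y Z V W) :
    ∀ w, Rec w → ∀ P, Dag.B10_main (leavesP w P) := by
  intro w hw P
  obtain ⟨𝔠, X, 𝔖, 𝔄, Xc, Y, Z, V, W, hα, hup⟩ := hpin w hw P
  exact b10_main_constructedLE_upC hα hup

/-! ## §4 The bridge BY NAME to the lane's END-theorem objects (`UVStability3DInputs.laneT`, `Theorems.runs`) -/

section LaneT

variable (𝔠f : ∀ (G : Type) [GaugeGroup G] [MeasurableSpace G] [HaarData G] (𝔊 : GroupModel G), AlphaConsts L 𝔊.N)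
  (Xf : ∀ (G : Type) [GaugeGroup G] [MeasurableSpace G] [HaarData G], GroupModel G → ∀ S : Scales L, ExternalInputs S G)
  (𝔖f : ∀ (G : Type) [GaugeGroup G] [MeasurableSpace G] [HaarData G] (𝔊 : GroupModel G) (S : Scales L) (k : ℕ),
    StepSeries S G ↥(lieC 𝔊) (nblkOf S (𝔠f G 𝔊).lane.carrier k) k)
  (G) (𝔊)

/-- **THE CONSTRUCTED RUN FAMILY OF §1′ IS THE END THEOREM'S** `Theorems.runs (laneT 𝔠 X 𝔖).toConstruction G 𝔊 (eps0Of (𝔠 G 𝔊).gamma0)` — the very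
family `UVStability3DInputs.not_literal_of_inputs` speaks about — at the ∀-group data specialised to the group `(G, 𝔊)` (`rfl`:
`TowerConstruction.toConstruction`, `Inputs.mkT`, `Inputs.towerOf`). [cite: Balaban1985UV3, (1)–(5) p.256 (dictionary, bookkeeping)] -/
theorem runs_laneT_eq :
    runs (laneT 𝔠f Xf 𝔖f).toConstruction G 𝔊 (eps0Of (𝔠f G 𝔊).gamma0) =
      fun S : Family L (eps0Of (𝔠f G 𝔊).gamma0) => (towerOf (𝔠f G 𝔊).lane (Xf G 𝔊 S.1) (𝔖f G 𝔊 S.1)).toRunData :=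
  rfl

/-- Carriers whose B10 runs are the towers of §1′ ARE the carriers re-indexed by the END theorem's run family (`rfl`). [cite: Balaban1985UV3, (1)–(5) p.256 (dictionary, bookkeeping)] -/
theorem withTowerRuns10_laneT_eq (Xc : PrintedCarriersR) :
    Xc.withTowerRuns10 (fun S : Family L (eps0Of (𝔠f G 𝔊).gamma0) =>
        towerOf (𝔠f G 𝔊).lane (Xf G 𝔊 S.1) (𝔖f G 𝔊 S.1)) =
      { Xc with I10 := Family L (eps0Of (𝔠f G 𝔊).gamma0),
                runs10 := runs (laneT 𝔠f Xf 𝔖f).toConstruction G 𝔊 (eps0Of (𝔠f G 𝔊).gamma0) } :=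
  rfl

/-- **THE C-BINDING'S LEAF OVER THE END THEOREM'S RUN FAMILY, UNFOLDED** (`Iff.rfl`): it is EXACTLY «`B10.Thm1PrintedCompact (runs …) ∧ B10.Thm2Printed (runs …)`»
— the first conjunct of `UVStability3DInputs.not_literal_of_inputs` ∕ the `eps0Of` witness inside `uvStability3D_of_inputs`. [cite: Balaban1985UV3, Thm 1 p.257 (compact reading) + Thm 2 p.272] -/
theorem ofPrintedAllXPNC_laneT_b10_iff (Xc : PrintedCarriersR) (Y : PrintedCarriers9X) (Z : PrintedCarriers11) (V : PrintedCarriers14R)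
    (W : PrintedCarriers15) :
    (ofPrintedAllXPNC { Xc with I10 := Family L (eps0Of (𝔠f G 𝔊).gamma0),
                                runs10 := runs (laneT 𝔠f Xf 𝔖f).toConstruction G 𝔊 (eps0Of (𝔠f G 𝔊).gamma0) } Y Z V W).b10 ↔
      Thm1PrintedCompact (runs (laneT 𝔠f Xf 𝔖f).toConstruction G 𝔊 (eps0Of (𝔠f G 𝔊).gamma0)) ∧
        Thm2Printed (runs (laneT 𝔠f Xf 𝔖f).toConstruction G 𝔊 (eps0Of (𝔠f G 𝔊).gamma0)) :=
  Iff.rfl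

/-- **N08 BY NAME OVER THE END THEOREM'S RUN FAMILY**: at `w.up P = ofPrintedAllXPNC {Xc with runs10 := Theorems.runs (laneT 𝔠 X 𝔖).toConstruction G 𝔊
(eps0Of γ₀)} Y Z V W`, the (α) inputs of the group `(G, 𝔊)` on the exhibited family give `Dag.B10_main (leavesP w P)` (§1′ through `withTowerRuns10_laneT_eq`).
[cite: Balaban1985UV3, Thm 1 p.257 (compact reading) + Thm 2 p.272 + p.256 L15–18] -/
theorem b10_main_laneT_upC
    {𝔄 : ∀ S : Scales L, AlphaData 𝔊 (𝔠f G 𝔊) (Xf G 𝔊 S) (𝔖f G 𝔊 S)}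
    (hα : ∀ S : Scales L, S.ε₀ = eps0Of (𝔠f G 𝔊).gamma0 S.g → RunAlpha 𝔊 (𝔠f G 𝔊) (Xf G 𝔊 S) (𝔖f G 𝔊 S) (𝔄 S))
    {Xc : PrintedCarriersR}
    (hup : w.up P = ofPrintedAllXPNC { Xc with I10 := Family L (eps0Of (𝔠f G 𝔊).gamma0),
                                               runs10 := runs (laneT 𝔠f Xf 𝔖f).toConstruction G 𝔊 (eps0Of (𝔠f G 𝔊).gamma0) } Y Z V W) :
    Dag.B10_main (leavesP w P) :=
  b10_main_constructed_upC (𝔠 := 𝔠f G 𝔊) (X := Xf G 𝔊) (𝔖 := 𝔖f G 𝔊) hα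
    (hup.trans (congrArg (fun X' => ofPrintedAllXPNC X' Y Z V W) (withTowerRuns10_laneT_eq G 𝔊 𝔠f Xf 𝔖f Xc).symm))

/-- … and for the ∀-group (α) inputs of `uvStability3D_of_inputs` verbatim (every group), at the group `(G, 𝔊)` of the binding.
[cite: Balaban1985UV3, Thm 1 p.257 (compact reading) + Thm 2 p.272 + p.256 L15–18] -/
theorem b10_main_laneT_upC_of_inputs
    (𝔄f : ∀ (G : Type) [GaugeGroup G] [MeasurableSpace G] [HaarData G] (𝔊 : GroupModel G) (S : Scales L),
      AlphaData 𝔊 (𝔠f G 𝔊) (Xf G 𝔊 S) (𝔖f G 𝔊 S))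
    (hα : ∀ (G : Type) [GaugeGroup G] [MeasurableSpace G] [HaarData G] (𝔊 : GroupModel G) (S : Scales L),
      S.ε₀ = eps0Of (𝔠f G 𝔊).gamma0 S.g → RunAlpha 𝔊 (𝔠f G 𝔊) (Xf G 𝔊 S) (𝔖f G 𝔊 S) (𝔄f G 𝔊 S))
    {Xc : PrintedCarriersR}
    (hup : w.up P = ofPrintedAllXPNC { Xc with I10 := Family L (eps0Of (𝔠f G 𝔊).gamma0),
                                               runs10 := runs (laneT 𝔠f Xf 𝔖f).toConstruction G 𝔊 (eps0Of (𝔠f G 𝔊).gamma0) } Y Z V W) :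
    Dag.B10_main (leavesP w P) :=
  b10_main_laneT_upC G 𝔊 𝔠f Xf 𝔖f (hα G 𝔊) hup

end LaneT

end Summit.QuantumFields.YangMills.Theorems.BalabanUVNodesN08Constructed
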